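import Mathlib
import Summits.CriticalPhenomena.PercolationContinuityZ3.Theorems.PercNearOneGluingNoHeavyLowerTailOrientedAntipodalHallWordsTwo

/-!
# The rank socket for Conjecture W2: signed incidence rows (`R3±-W2` / `DR-W2`)

Helper file for crux `stmt-CriticalPhenomena-4575` (`NoHeavyLowerTail`, route `PercNearOneGluingNoHeavy`),
new-inequality factory seat `prim-ineq-gen-3` (gen 18).  Everything here is PROVED; no definitions.

CONJECTURE W2 asks for `#D ≤ #W2(D)`, `W2(D)` the co-good words of length two of a co-intersecting family `D` of antipodal
bads (memo `run/shared/lean/prim/prim-ineq-gen-3/CONJECTURE-W2.md`).  Gen 18 found (memo `CONJECTURE-G3.md` §3, §5) that on every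
instance either programme has produced — including all families on which the ORDERED certificates of gens 16–17 and of prim-hp-7
fail — there is a SIGN choice `σ : D → {member, bad}` such that the `#D` incidence rows `G ↦ [G ⊆ g X]` (`g X = S \ X` or `g X = X`),
`G` ranging over `W2(D)`, are linearly independent over `ℚ` (CONJECTURE `R3±-W2`; choice-free form `DR-W2` by Rado's theorem).
This file is the (elementary) SOCKET turning such a certificate into the W2 count:

* `card_le_card_of_linearIndependent_rows` — `#D` linearly independent vectors in `ℚ^T` force `#D ≤ #T` (any finite index and
  target families; the representatives `g X` may be ANY sets, so pseudo-set certificates are covered as well);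
* `card_le_card_wordsTwo_of_rankCert` — the specialisation to the co-good words of length two, in the exact form consumed by the
  W2 socket `exists_injective_good_above_of_wordsTwo` (apply it to every sub-family to get distinct good representatives).
(prim-ineq-gen-3 gen 18, 2026-08-23.)
-/

namespace Summit.CriticalPhenomena.PercolationContinuityZ3.Theorems

namespace OrientedAntipodalHall

open Finset AntipodalStrongHarris AntipodalStrongHarris.Lab
open scoped FinsetFamily

variable {α : Type*} [DecidableEq α] {k : ℕ}

/-- **Rank socket (abstract form).**  If the incidence rows `G ↦ [G ⊆ g X]` (`X ∈ D`, `G ∈ T`) of some set-valued representative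
map `g` are linearly independent over `ℚ`, then `#D ≤ #T`. -/
theorem card_le_card_of_linearIndependent_rows (D T : Finset (Finset α)) (g : Finset α → Finset α)
    (hlin : LinearIndependent ℚ (fun X : D => fun G : T => if (G : Finset α) ⊆ g X then (1 : ℚ) else 0)) :
    #D ≤ #T := by
  classical
  have h := hlin.fintype_card_le_finrank
  rw [Module.finrank_fintype_fun_eq_card, Fintype.card_coe, Fintype.card_coe] at h
  exact h

/-- **Rank socket for W2 (`R3±-W2` certificate ⟹ W2 count).**  Let `D` be a family of bads inside `S` and `g` any choice of
representatives (intended: `g X = S \ X`, the member, or `g X = X`, the bad — the sign choice of CONJECTURE `R3±-W2`).  If the rows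
`G ↦ [G ⊆ g X]`, `G` ranging over the co-good words of length two of `D`, are linearly independent over `ℚ`, then `D` has at most as
many members as there are such words. -/
theorem card_le_card_wordsTwo_of_rankCert (S : Finset α) (f : Finset α → Lab k) (D : Finset (Finset α))
    (g : Finset α → Finset α)
    (hlin : LinearIndependent ℚ (fun X : D => fun G : ({G ∈ S.powerset | f G = bot ∧ f (S \ G) = top ∧
        ∃ X ∈ D, ∃ Y ∈ D, G = (S \ X) \ (S \ Y) ∨ G = (S \ X) ∩ (S \ Y)} : Finset (Finset α)) =>
        if (G : Finset α) ⊆ g X then (1 : ℚ) else 0)) :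
    #D ≤ #{G ∈ S.powerset | f G = bot ∧ f (S \ G) = top ∧
      ∃ X ∈ D, ∃ Y ∈ D, G = (S \ X) \ (S \ Y) ∨ G = (S \ X) ∩ (S \ Y)} :=
  card_le_card_of_linearIndependent_rows D _ g hlin

/-- **From rank certificates on all sub-families to Hall.**  If every sub-family `D'` of `D` admits representatives whose incidence
rows over the co-good words of length two of `D'` are linearly independent, then `D` has distinct good representatives
(`exists_injective_good_above_of_wordsTwo`). -/
theorem exists_injective_good_above_of_rankCert (S : Finset α) {f : Finset α → Lab k}
    (D : Finset (Finset α)) (hDS : ∀ X ∈ D, X ⊆ S)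
    (hcert : ∀ D' ⊆ D, ∃ g : Finset α → Finset α,
      LinearIndependent ℚ (fun X : D' => fun G : ({G ∈ S.powerset | f G = bot ∧ f (S \ G) = top ∧
        ∃ X ∈ D', ∃ Y ∈ D', G = (S \ X) \ (S \ Y) ∨ G = (S \ X) ∩ (S \ Y)} : Finset (Finset α)) =>
        if (G : Finset α) ⊆ g X then (1 : ℚ) else 0)) :
    ∃ φ : D → Finset α, Function.Injective φ ∧
      ∀ X : D, (X : Finset α) ⊆ φ X ∧ φ X ⊆ S ∧ f (φ X) = top ∧ f (S \ φ X) = bot := by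
  refine exists_injective_good_above_of_wordsTwo S D hDS fun D' hD' => ?_
  obtain ⟨g, hg⟩ := hcert D' hD'
  exact card_le_card_wordsTwo_of_rankCert S f D' g hg

end OrientedAntipodalHall

end Summit.CriticalPhenomena.PercolationContinuityZ3.Theorems
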